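import Summits.CriticalPhenomena.CardyFormulaZ2.Theorems.CardyBoundaryCoulombGasBoundaryDefectGaussianRS17DictionaryOfPart1
import Summits.CriticalPhenomena.CardyFormulaZ2.Theorems.CardyBoundaryCoulombGasBoundaryDefectGaussianRS17UncutLoopTurning

/-!
# Stub `s17_dictionary_of` of line `rainbow-monomials-in-excursion-kernels` — Part 2:
# evaluation of the abstract strand product: uncut loops weigh `1`, strands a prescribed phase
# (crux `BoundaryDefectGaussianR`, stmt-CriticalPhenomena-14132; insertion dictionary D2, count assembly)

Second of three files. Part 1 rewrote, for a collar leg model `M` and `ω ⊆ E`, the sum over the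
height configurations `Σ_h ∏_c turnFactor h (cfgOf ω) c` as the left-hand side of the abstract
Baxter–Kelland–Wu strand expansion of Part 5 (`bkwStrand_sum_consistent_forced`) for the turning
rule `σ` of `cfgOf ω` on the corners `C` over the piece, the cut corners `B`, the forced bits
`o = bit h₀` and the phases `g = (π/12) turnSign (cfgOf ω)` off `B`, `0` on `B`. Its right-hand
side is `∏_{S uncut cycle} 2cos(Σ_{c∈S} g c) · ∏_{b ∈ B} exp(i ε(o b) Σ_{c ∈ T_b} g c)`, `T_b` the
strand ending at `b`. This file evaluates it:

* `dict_two_cos_uncut_eq_one` — an uncut cycle is a cycle of minimal period `Q` of the turning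
  rule containing no cut, so `Σ_{c∈S} g c = (π/12) Σ_{m<Q} turnSign = ±π/3` by the Umlaufsatz
  (`s17_uncutLoopTurning`) and `2cos(±π/3) = 1`: **closed loops weigh `1`**;
* `dict_strand_untracked` — the strand ending at an UNTRACKED cut `b` is `{b}` (the successor of
  a non-cut corner is tracked), so its phase is `exp(i ε · 0) = 1`;
* `dict_strand_eq_image` / `dict_sum_strand_eq` — the strand ending at a TRACKED cut `b` is
  `{e, σ e, …, σⁿ e = b}` for any tracked start `e` (successor of a cut) joined to `b` through
  non-cuts, so `Σ_{c ∈ T_b} g c = (π/12) Σ_{m<n} turnSign (cfgOf ω) (σᵐ e)`;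
* `dict_bkw_rhs_eq` — hence, given for every tracked cut `b` such a start with turning sum `X b`
  (hypothesis `hstart`), the right-hand side is `Θ = ∏_{b tracked cut} exp(i ε(o b) (π/12) X b)`;
* `dict_sum_configs_eq_strandPhase` — with Part 1 and Part 5:
  `Σ_{h ∈ configs} ∏_c turnFactor h (cfgOf ω) c = Θ`.

Registered sub-goal carried here: `s17_dictionary_of_part2` (one-line form of the last theorem).
-/

namespace Summit.CriticalPhenomena.CardyFormulaZ2.Cruxes.BoundaryDefectGaussianR.RainbowMonomialsInExcursionKernels

open Finset Literature.Probability.LatticeModels Literature.Probability.LatticeModels.CollarLegModel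
open Literature.Probability.Percolation Literature.GroupTheory.CombinatorialGroupTheory

section Evaluation

variable {M : CollarLegModel} {ω : Finset ((ℤ × ℤ) × Bool)} (σ : Equiv.Perm ↥(cornerSet M.piece))
  (hσ : ∀ c, ((σ c : ↥(cornerSet M.piece)) : Site 2 × Fin 4) = nextCorner (M.cfgOf ω) c)

include hσ in
/-- Powers of the restricted permutation are iterates of the turning rule. [folklore] -/
theorem dict_pow_apply_val (n : ℕ) (c : ↥(cornerSet M.piece)) :
    (((σ ^ n) c : ↥(cornerSet M.piece)) : Site 2 × Fin 4) = (nextCorner (M.cfgOf ω))^[n] c := by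
  induction n with
  | zero => simp
  | succ n ih => rw [pow_succ', Equiv.Perm.mul_apply, hσ, ih, Function.iterate_succ_apply']

/-- Every corner of the (finite) type of corners over the piece is periodic for `σ`. [folklore] -/
theorem dict_mem_periodicPts (c : ↥(cornerSet M.piece)) : c ∈ Function.periodicPts σ :=
  Function.mk_mem_periodicPts (orderOf_pos σ) (by
    show (⇑σ)^[orderOf σ] c = c
    rw [← Equiv.Perm.coe_pow, pow_orderOf_eq_one, Equiv.Perm.coe_one, id])

/-- **A cycle of `σ` is enumerated by the first `Q` iterates of any of its corners**, `Q` the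
minimal period: `Σ_{c ∈ cls σ c₀} F c = Σ_{m<Q} F (σᵐ c₀)`. [folklore] -/
theorem dict_sum_cls_eq (c₀ : ↥(cornerSet M.piece)) (F : ↥(cornerSet M.piece) → ℂ) :
    ∑ c ∈ PairingGenus.cls σ c₀, F c = ∑ m ∈ range (Function.minimalPeriod σ c₀), F ((σ ^ m) c₀) := by
  have hp := dict_mem_periodicPts σ c₀
  have hQ := Function.minimalPeriod_pos_of_mem_periodicPts hp
  have himage : PairingGenus.cls σ c₀ = (range (Function.minimalPeriod σ c₀)).image fun m => (σ ^ m) c₀ := by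
    ext y
    rw [PairingGenus.mem_cls, mem_image]
    constructor
    · intro h
      obtain ⟨n, rfl⟩ := h.exists_nat_pow_eq
      refine ⟨n % Function.minimalPeriod σ c₀, mem_range.2 (Nat.mod_lt _ hQ), ?_⟩
      rw [Equiv.Perm.coe_pow, Equiv.Perm.coe_pow, Function.iterate_mod_minimalPeriod_eq]
    · rintro ⟨m, -, rfl⟩
      exact ⟨m, by rw [zpow_natCast]⟩
  rw [himage, sum_image]
  intro a ha b hb h
  rw [coe_range] at ha hb
  simp only [Equiv.Perm.coe_pow] at h
  exact Function.iterate_injOn_Iio_minimalPeriod ha hb h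

include hσ in
/-- **Closed loops weigh `1`.** For an uncut cycle `S` of `σ` (no cut corner on it) and the phases
`g = (π/12) turnSign (cfgOf ω)` off the cuts, `2cos(Σ_{c∈S} g c) = 1`: the cycle is a cycle of
minimal period of the turning rule, whose turn signs add up to `±4` (`s17_uncutLoopTurning`), and
`2cos(±π/3) = 1`. [cite: BaxterKellandWu1976, §3] -/
theorem dict_two_cos_uncut_eq_one [DecidablePred M.IsCut] (B : Finset ↥(cornerSet M.piece))
    (hB : ∀ c, c ∈ B ↔ M.IsCut c.1) (g : ↥(cornerSet M.piece) → ℝ)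
    (hg : ∀ c, g c = if M.IsCut c.1 then (0 : ℝ) else Real.pi / 12 * (turnSign (M.cfgOf ω) c.1 : ℝ))
    {S : Finset ↥(cornerSet M.piece)} (hS : S ∈ (BKW.cycles σ).filter (fun S => Disjoint S B)) :
    2 * Complex.cos (∑ c ∈ S, (g c : ℂ)) = 1 := by
  obtain ⟨hS, hdisj⟩ := mem_filter.1 hS
  obtain ⟨c₀, -, rfl⟩ := mem_image.1 hS
  set Q := Function.minimalPeriod σ c₀ with hQdef
  have hp := dict_mem_periodicPts σ c₀
  have hQ : 0 < Q := Function.minimalPeriod_pos_of_mem_periodicPts hp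
  -- the cycle of `c₀` under the turning rule, of minimal period `Q`
  have hcyc : (nextCorner (M.cfgOf ω))^[Q] (c₀ : Site 2 × Fin 4) = c₀ := by
    rw [← dict_pow_apply_val σ hσ, Equiv.Perm.coe_pow, hQdef, Function.iterate_minimalPeriod]
  have hmin : ∀ s, 0 < s → s < Q → (nextCorner (M.cfgOf ω))^[s] (c₀ : Site 2 × Fin 4) ≠ c₀ := by
    intro s hs hsQ heq
    refine Function.not_isPeriodicPt_of_pos_of_lt_minimalPeriod hs.ne' hsQ ?_
    show (⇑σ)^[s] c₀ = c₀
    rw [← Equiv.Perm.coe_pow]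
    exact Subtype.ext (by rw [dict_pow_apply_val σ hσ, heq])
  -- no cut on it: the phases are `(π/12) turnSign`
  have hsum : ∑ c ∈ PairingGenus.cls σ c₀, (g c : ℂ) =
      ((Real.pi / 12 : ℝ) : ℂ) * ((∑ m ∈ range Q, turnSign (M.cfgOf ω) ((nextCorner (M.cfgOf ω))^[m] c₀) : ℤ) : ℂ) := by
    rw [dict_sum_cls_eq σ c₀, Int.cast_sum, mul_sum]
    refine sum_congr rfl fun m _ => ?_
    have hm : (σ ^ m) c₀ ∈ PairingGenus.cls σ c₀ := PairingGenus.mem_cls.2 ⟨m, by rw [zpow_natCast]⟩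
    have hcut : ¬M.IsCut ((σ ^ m) c₀).1 := fun h => disjoint_left.1 hdisj hm ((hB _).2 h)
    rw [hg, if_neg hcut, dict_pow_apply_val σ hσ]
    push_cast
    ring
  rw [hsum]
  rcases s17_uncutLoopTurning M ω c₀ Q hQ hcyc hmin with h4 | h4 <;> rw [h4]
  · rw [show ((Real.pi / 12 : ℝ) : ℂ) * ((4 : ℤ) : ℂ) = ((Real.pi / 3 : ℝ) : ℂ) by push_cast; ring,
      ← Complex.ofReal_cos, Real.cos_pi_div_three]
    push_cast; ring
  · rw [show ((Real.pi / 12 : ℝ) : ℂ) * ((-4 : ℤ) : ℂ) = -((Real.pi / 3 : ℝ) : ℂ) by push_cast; ring, Complex.cos_neg,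
      ← Complex.ofReal_cos, Real.cos_pi_div_three]
    push_cast; ring

/-- The successor of a non-cut corner in the completed configuration of `ω ⊆ E` is tracked (a live
target has tracked corners on both sides; a frozen non-cut turn is a consistent tracked turn of the
prescribed data, and the turning rule at a frozen target does not see `ω`). [folklore] -/
theorem dict_isTracked_nextCorner_of_not_isCut (hω : ω ⊆ M.E) {c : Site 2 × Fin 4} (hc : ¬M.IsCut c) :
    M.IsTracked (nextCorner (M.cfgOf ω) c) := by
  by_cases hl : M.TargetsLive c
  · exact (perCfg_isTracked_of_targetsLive M (M.cfgOf ω) hl).2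
  · have h0 : M.TurnConsistent (fun _ => 0) (M.cfgOf ∅) c := by
      by_contra h'; exact hc ⟨hl, h'⟩
    rw [nextCorner_cfgOf_eq_of_not_targetsLive hω hl]
    exact h0.2.1

include hσ in
/-- **The strand ending at an untracked cut is trivial**: every corner whose first cut along `σ` is
an untracked cut `b` is `b` itself. [folklore] -/
theorem dict_strand_untracked (hω : ω ⊆ M.E) (B : Finset ↥(cornerSet M.piece)) (hB : ∀ c, c ∈ B ↔ M.IsCut c.1)
    {b : ↥(cornerSet M.piece)} (hbt : ¬M.IsTracked b.1) {c : ↥(cornerSet M.piece)} {k : ℕ}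
    (hk : (σ ^ k) c = b) (hkl : ∀ l < k, (σ ^ l) c ∉ B) : c = b := by
  rcases k with _ | k
  · simpa using hk
  · exfalso
    apply hbt
    have hcut : ¬M.IsCut ((σ ^ k) c).1 := fun h => hkl k k.lt_succ_self ((hB _).2 h)
    have := dict_isTracked_nextCorner_of_not_isCut hω hcut
    rwa [← hσ, ← Equiv.Perm.mul_apply, ← pow_succ', hk] at this

/-- **The strand ending at a tracked cut.** If `e` is a corner over the piece whose predecessor is a
cut, `σⁿ e = b` and `σᵐ e` is no cut for `m < n`, then the corners `e, σ e, …, σⁿ e` are pairwise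
distinct. [folklore] -/
theorem dict_strand_injOn (B : Finset ↥(cornerSet M.piece)) {e b : ↥(cornerSet M.piece)} {n : ℕ}
    (hb : b ∈ B) (hn : (σ ^ n) e = b) (hnl : ∀ m < n, (σ ^ m) e ∉ B) :
    Set.InjOn (fun m => (σ ^ m) e) ↑(range (n + 1)) := by
  -- a coincidence makes `e` periodic with a period `p ≤ n`, and then `b = σ^(n % p') e` is no cut
  have key : ∀ i j, i < j → j ≤ n → (σ ^ i) e = (σ ^ j) e → False := by
    intro i j hij hj hEq
    have hper : Function.IsPeriodicPt σ (j - i) e := by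
      show (⇑σ)^[j - i] e = e
      apply (σ ^ i).injective
      rw [← Equiv.Perm.coe_pow, ← Equiv.Perm.mul_apply, ← pow_add, Nat.add_sub_cancel' hij.le]
      exact hEq.symm
    have hp0 : 0 < j - i := Nat.sub_pos_of_lt hij
    have hle := hper.minimalPeriod_le hp0
    have hpos := hper.minimalPeriod_pos hp0
    have hlt : n % Function.minimalPeriod σ e < n := (Nat.mod_lt _ hpos).trans_le (by omega)
    apply hnl _ hlt
    rw [Equiv.Perm.coe_pow, Function.iterate_mod_minimalPeriod_eq, ← Equiv.Perm.coe_pow, hn]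
    exact hb
  intro i hi j hj hEq
  rw [coe_range, Set.mem_Iio] at hi hj
  rcases lt_trichotomy i j with h | h | h
  · exact (key i j h (Nat.lt_succ_iff.1 hj) hEq).elim
  · exact h
  · exact (key j i h (Nat.lt_succ_iff.1 hi) hEq.symm).elim

/-- **The strand ending at a tracked cut `b` is `{e, σ e, …, σⁿ e}`** for a start `e` (successor of a
cut corner `c₀` over the piece) with `σⁿ e = b` through non-cuts. [cite: BaxterKellandWu1976, §3] -/
theorem dict_strand_eq_image (B : Finset ↥(cornerSet M.piece)) {e b c₀ : ↥(cornerSet M.piece)} {n : ℕ}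
    (hb : b ∈ B) (hc₀ : c₀ ∈ B) (he : σ c₀ = e) (hn : (σ ^ n) e = b) (hnl : ∀ m < n, (σ ^ m) e ∉ B) :
    univ.filter (fun c => ∃ k < Fintype.card ↥(cornerSet M.piece), (σ ^ k) c = b ∧ ∀ l < k, (σ ^ l) c ∉ B) =
      (range (n + 1)).image (fun m => (σ ^ m) e) := by
  have hinj := dict_strand_injOn σ B hb hn hnl
  have hcard : n < Fintype.card ↥(cornerSet M.piece) := by
    have := card_le_univ ((range (n + 1)).image (fun m => (σ ^ m) e))
    rw [card_image_of_injOn hinj, card_range] at this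
    exact this
  ext c
  simp only [mem_filter, mem_univ, true_and, mem_image, mem_range]
  constructor
  · rintro ⟨k, -, hkb, hkl⟩
    by_cases hkn : k ≤ n
    · refine ⟨n - k, by omega, (σ ^ k).injective ?_⟩
      rw [← Equiv.Perm.mul_apply, ← pow_add, Nat.add_sub_cancel' hkn, hn, hkb]
    · exfalso
      push Not at hkn
      refine hkl (k - n - 1) (by omega) ?_
      have h1 : (σ ^ (n + 1)) ((σ ^ (k - n - 1)) c) = (σ ^ (n + 1)) c₀ := by
        rw [← Equiv.Perm.mul_apply, ← pow_add, show n + 1 + (k - n - 1) = k by omega, hkb, pow_succ,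
          Equiv.Perm.mul_apply, he, hn]
      rw [(σ ^ (n + 1)).injective h1]
      exact hc₀
  · rintro ⟨m, hm, rfl⟩
    refine ⟨n - m, by omega, ?_, fun l hl => ?_⟩
    · rw [← Equiv.Perm.mul_apply, ← pow_add, Nat.sub_add_cancel (Nat.lt_succ_iff.1 hm), hn]
    · rw [← Equiv.Perm.mul_apply, ← pow_add]
      exact hnl _ (by omega)

include hσ in
/-- **The phase of the strand ending at a tracked cut**: with `g = (π/12) turnSign (cfgOf ω)` off the
cuts and `0` on them, `Σ_{c ∈ T_b} g c = (π/12) Σ_{m<n} turnSign (cfgOf ω) (σᵐ e)`. [cite: BaxterKellandWu1976, §3] -/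
theorem dict_sum_strand_eq [DecidablePred M.IsCut] (hω : ω ⊆ M.E) (B : Finset ↥(cornerSet M.piece))
    (hB : ∀ c, c ∈ B ↔ M.IsCut c.1) (g : ↥(cornerSet M.piece) → ℝ)
    (hg : ∀ c, g c = if M.IsCut c.1 then (0 : ℝ) else Real.pi / 12 * (turnSign (M.cfgOf ω) c.1 : ℝ))
    {b : ↥(cornerSet M.piece)} (hb : b ∈ B) {e : Site 2 × Fin 4} {n : ℕ} (he : M.IsTracked e)
    (hstart : ∃ c₀, M.IsCut c₀ ∧ nextCorner (M.cfgOf ∅) c₀ = e) (hn : (nextCorner (M.cfgOf ω))^[n] e = b)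
    (hnl : ∀ m < n, ¬M.IsCut ((nextCorner (M.cfgOf ω))^[m] e)) :
    ∑ c ∈ univ.filter (fun c => ∃ k < Fintype.card ↥(cornerSet M.piece), (σ ^ k) c = b ∧ ∀ l < k, (σ ^ l) c ∉ B),
        (g c : ℂ) =
      ((Real.pi / 12 * (∑ m ∈ range n, turnSign (M.cfgOf ω) ((nextCorner (M.cfgOf ω))^[m] e) : ℤ) : ℝ) : ℂ) := by
  obtain ⟨c₀, hc₀, hc₀e⟩ := hstart
  have hc₀e' : nextCorner (M.cfgOf ω) c₀ = e := by rw [nextCorner_cfgOf_eq_of_not_targetsLive hω hc₀.1, hc₀e]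
  have hem : e ∈ cornerSet M.piece := mem_cornerSet_of_isTracked he
  have hc₀m : c₀ ∈ cornerSet M.piece := (nextCorner_cfgOf_mem_cornerSet_iff M hω c₀).1 (hc₀e' ▸ hem)
  set ê : ↥(cornerSet M.piece) := ⟨e, hem⟩ with hê
  have hval : ∀ m, (((σ ^ m) ê : ↥(cornerSet M.piece)) : Site 2 × Fin 4) = (nextCorner (M.cfgOf ω))^[m] e :=
    fun m => dict_pow_apply_val σ hσ m ê
  have hn' : (σ ^ n) ê = b := Subtype.ext (by rw [hval, hn])
  have hnl' : ∀ m < n, (σ ^ m) ê ∉ B := fun m hm h => hnl m hm (by rw [← hval]; exact (hB _).1 h)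
  have hσc₀ : σ ⟨c₀, hc₀m⟩ = ê := Subtype.ext (by rw [hσ]; exact hc₀e')
  rw [dict_strand_eq_image σ B hb ((hB ⟨c₀, hc₀m⟩).2 hc₀) hσc₀ hn' hnl',
    sum_image (dict_strand_injOn σ B hb hn' hnl'), sum_range_succ, hn', hg b, if_pos ((hB b).1 hb)]
  have hR : ((Real.pi / 12 * (∑ m ∈ range n, turnSign (M.cfgOf ω) ((nextCorner (M.cfgOf ω))^[m] e) : ℤ) : ℝ) : ℂ) =
      ∑ m ∈ range n, ((Real.pi / 12 : ℝ) : ℂ) * (turnSign (M.cfgOf ω) ((nextCorner (M.cfgOf ω))^[m] e) : ℂ) := by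
    push_cast; rw [mul_sum]
  rw [hR, Complex.ofReal_zero, add_zero]
  refine sum_congr rfl fun m hm => ?_
  rw [hg, if_neg (fun h => hnl' m (mem_range.1 hm) ((hB _).2 h)), hval]
  push_cast
  ring

include hσ in
/-- **Evaluation of the abstract strand product.** For the turning rule `σ` of `cfgOf ω`, `ω ⊆ E`, on
the corners over the piece, the cut corners `B`, the phases `g = (π/12) turnSign (cfgOf ω)` off `B` and
`0` on `B`, and bits `o`: if every TRACKED cut `b` is reached through non-cuts from a tracked start
`e` (successor of a cut) with turning sum `X b` (hypothesis `hstart`), then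
`∏_{S uncut} 2cos(Σ_S g) · ∏_{b ∈ B} exp(i ε(o b) Σ_{T_b} g) = ∏_{b tracked cut} exp(i ε(o b) (π/12) X b)`
(uncut loops weigh `1`, untracked cuts end trivial strands). [cite: BaxterKellandWu1976, §3–§4] -/
theorem dict_bkw_rhs_eq [DecidablePred M.IsCut] (hω : ω ⊆ M.E) (B : Finset ↥(cornerSet M.piece))
    (hB : ∀ c, c ∈ B ↔ M.IsCut c.1) (g : ↥(cornerSet M.piece) → ℝ)
    (hg : ∀ c, g c = if M.IsCut c.1 then (0 : ℝ) else Real.pi / 12 * (turnSign (M.cfgOf ω) c.1 : ℝ))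
    (o : ↥(cornerSet M.piece) → Bool) (o' : Site 2 × Fin 4 → Bool) (ho : ∀ c, o c = o' c.1)
    (X : Site 2 × Fin 4 → ℤ)
    (hstart : ∀ b, M.IsTracked b → M.IsCut b → ∃ (e : Site 2 × Fin 4) (n : ℕ), M.IsTracked e ∧
      (∃ c₀, M.IsCut c₀ ∧ nextCorner (M.cfgOf ∅) c₀ = e) ∧ (nextCorner (M.cfgOf ω))^[n] e = b ∧
      (∀ m < n, ¬M.IsCut ((nextCorner (M.cfgOf ω))^[m] e)) ∧
      ∑ m ∈ range n, turnSign (M.cfgOf ω) ((nextCorner (M.cfgOf ω))^[m] e) = X b) :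
    (∏ S ∈ (BKW.cycles σ).filter (fun S => Disjoint S B), 2 * Complex.cos (∑ c ∈ S, (g c : ℂ))) *
        ∏ b ∈ B, Complex.exp (Complex.I * (BKW.sgn (o b) : ℂ) * ∑ c ∈ univ.filter
          (fun c => ∃ k < Fintype.card ↥(cornerSet M.piece), (σ ^ k) c = b ∧ ∀ l < k, (σ ^ l) c ∉ B), (g c : ℂ)) =
      ∏ b ∈ (cornerSet M.piece).filter (fun c => M.IsTracked c ∧ M.IsCut c),
        Complex.exp (Complex.I * (BKW.sgn (o' b) : ℂ) * ((Real.pi / 12 * (X b : ℝ) : ℝ) : ℂ)) := by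
  rw [prod_eq_one (fun S hS => dict_two_cos_uncut_eq_one σ hσ B hB g hg hS), one_mul]
  -- strand by strand
  have hstr : ∀ b ∈ B, Complex.exp (Complex.I * (BKW.sgn (o b) : ℂ) * ∑ c ∈ univ.filter
      (fun c => ∃ k < Fintype.card ↥(cornerSet M.piece), (σ ^ k) c = b ∧ ∀ l < k, (σ ^ l) c ∉ B), (g c : ℂ)) =
      if M.IsTracked b.1 then Complex.exp (Complex.I * (BKW.sgn (o' b.1) : ℂ) * ((Real.pi / 12 * (X b.1 : ℝ) : ℝ) : ℂ))
      else 1 := by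
    intro b hb
    have hcut : M.IsCut b.1 := (hB b).1 hb
    split_ifs with ht
    · obtain ⟨e, n, he, hst, hn, hnl, hX⟩ := hstart b.1 ht hcut
      rw [dict_sum_strand_eq σ hσ hω B hB g hg hb he hst hn hnl, hX, ho]
    · have hT : univ.filter (fun c => ∃ k < Fintype.card ↥(cornerSet M.piece), (σ ^ k) c = b ∧
          ∀ l < k, (σ ^ l) c ∉ B) = {b} := by
        refine eq_singleton_iff_unique_mem.2 ⟨?_, fun c hc => ?_⟩
        · exact mem_filter.2 ⟨mem_univ _, 0, Fintype.card_pos_iff.2 ⟨b⟩, rfl, fun l hl => absurd hl (Nat.not_lt_zero l)⟩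
        · obtain ⟨k, -, hk, hkl⟩ := (mem_filter.1 hc).2
          exact dict_strand_untracked σ hσ hω B hB ht hk hkl
      rw [hT, sum_singleton, hg, if_pos hcut]
      simp
  rw [prod_congr rfl hstr, ← prod_filter]
  -- back to a product over corners
  have hF : B.filter (fun b => M.IsTracked b.1) = univ.filter (fun b : ↥(cornerSet M.piece) => M.IsTracked b.1 ∧ M.IsCut b.1) := by
    ext b; simp only [mem_filter, mem_univ, true_and, hB b]; tauto
  rw [hF, prod_filter, prod_filter, ← prod_coe_sort (cornerSet M.piece)]

end Evaluation

/-! ### The per-configuration sum for a rainbow-like configuration -/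

/-- **`Σ_h ∏_c turnFactor h (cfgOf ω) c = Θ`.** For a collar leg model `M`, `ω ⊆ E`, a reference
configuration `h₀`, unit differences at the tracked corners of every valid configuration (Lemma V),
the frozen consistency transfer (Lemma C), forced bits on the cuts, heights-existence for `ω`, and,
for every tracked cut `b`, a tracked start `e` joined to `b` through non-cuts with turning sum `X b`:
the sum over the valid height configurations of the products of the turn factors is the unit complex
number `Θ = ∏_{b tracked cut} exp(i ε(bit h₀ b) (π/12) X b)` (Part 1, the abstract expansion of
Part 5, and `dict_bkw_rhs_eq`). [cite: BaxterKellandWu1976, §3–§4] -/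
theorem dict_sum_configs_eq_strandPhase {M : CollarLegModel} {ω : Finset ((ℤ × ℤ) × Bool)} [DecidablePred M.IsCut]
    (hω : ω ⊆ M.E) (h₀ : ↥M.freeCells → ℤ)
    (hunit : ∀ h ∈ M.configs, ∀ x ∈ M.vertexCells, ∀ f ∈ SixVertex.vertexFaces x, f ∈ M.faceCells →
      |M.hv h x - M.hf h f| = 1)
    (hC : ∀ h ∈ M.configs, ∀ c, ¬M.TargetsLive c →
      (M.TurnConsistent h (M.cfgOf ω) c ↔ M.TurnConsistent (fun _ => 0) (M.cfgOf ∅) c))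
    (hforced : ∀ h ∈ M.configs, ∀ c ∈ cornerSet M.piece, M.IsCut c → M.bit h c = M.bit h₀ c)
    (H5ω : ∀ s : Site 2 × Fin 4 → Bool,
      (∀ c ∈ cornerSet M.piece, ¬M.IsCut c → s (nextCorner (M.cfgOf ω) c) = s c) →
      (∀ c ∈ cornerSet M.piece, M.IsCut c → s c = M.bit h₀ c) →
        ∃ h ∈ M.configs, ∀ c ∈ cornerSet M.piece, M.bit h c = s c)
    (X : Site 2 × Fin 4 → ℤ)
    (hstart : ∀ b, M.IsTracked b → M.IsCut b → ∃ (e : Site 2 × Fin 4) (n : ℕ), M.IsTracked e ∧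
      (∃ c₀, M.IsCut c₀ ∧ nextCorner (M.cfgOf ∅) c₀ = e) ∧ (nextCorner (M.cfgOf ω))^[n] e = b ∧
      (∀ m < n, ¬M.IsCut ((nextCorner (M.cfgOf ω))^[m] e)) ∧
      ∑ m ∈ range n, turnSign (M.cfgOf ω) ((nextCorner (M.cfgOf ω))^[m] e) = X b) :
    ∑ h ∈ M.configs, ∏ c ∈ cornerSet M.piece, M.turnFactor h (M.cfgOf ω) c =
      ∏ b ∈ (cornerSet M.piece).filter (fun c => M.IsTracked c ∧ M.IsCut c),
        Complex.exp (Complex.I * (BKW.sgn (M.bit h₀ b) : ℂ) * ((Real.pi / 12 * (X b : ℝ) : ℝ) : ℂ)) := by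
  set σ : Equiv.Perm ↥(cornerSet M.piece) :=
    (cornerPerm (M.cfgOf ω)).subtypePerm (fun c => nextCorner_cfgOf_mem_cornerSet_iff M hω c) with hσdef
  have hσ : ∀ c, ((σ c : ↥(cornerSet M.piece)) : Site 2 × Fin 4) = nextCorner (M.cfgOf ω) c := fun c => rfl
  rw [dict_sum_configs_eq_sum_consistent σ hσ h₀ hunit hC hforced H5ω]
  have h5 := bkwStrand_sum_consistent_forced σ (univ.filter fun c : ↥(cornerSet M.piece) => M.IsCut c.1)
    (fun c => M.bit h₀ c.1)
    (fun c => if M.IsCut c.1 then (0 : ℝ) else Real.pi / 12 * (turnSign (M.cfgOf ω) c.1 : ℝ))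
  have h2 := dict_bkw_rhs_eq σ hσ hω (univ.filter fun c : ↥(cornerSet M.piece) => M.IsCut c.1) (by simp)
    (fun c => if M.IsCut c.1 then (0 : ℝ) else Real.pi / 12 * (turnSign (M.cfgOf ω) c.1 : ℝ)) (fun _ => rfl)
    (fun c => M.bit h₀ c.1) (M.bit h₀) (fun _ => rfl) X hstart
  rw [h2] at h5
  convert h5 using 2

/-! ### Registered sub-goal of this Part -/

/-- **Sub-goal `s17_dictionary_of_part2`** (registered on stmt-CriticalPhenomena-14132; D2 count
assembly, steps 1–3): for a collar leg model `M`, `ω ⊆ E`, a reference configuration `h₀` and a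
turning-sum function `X`, under Lemma V (unit differences), Lemma C (frozen consistency transfer),
forced bits on the cuts, heights-existence for `ω`, and the existence for every tracked cut `b` of a
tracked start joined to `b` through non-cuts with turning sum `X b`, the sum over the valid height
configurations of `∏_c turnFactor h (cfgOf ω) c` is the unit complex number
`∏_{b tracked cut} exp(i ε(bit h₀ b) (π/12) X b)`. [cite: BaxterKellandWu1976, §3–§4] -/
theorem s17_dictionary_of_part2 : ∀ (M : Literature.Probability.LatticeModels.CollarLegModel) (ω : Finset ((ℤ × ℤ) × Bool)) [DecidablePred M.IsCut] (h₀ : ↥M.freeCells → ℤ) (X : Literature.Probability.LatticeModels.Site 2 × Fin 4 → ℤ), ω ⊆ M.E → (∀ h ∈ M.configs, ∀ x ∈ M.vertexCells, ∀ f ∈ Literature.Probability.LatticeModels.SixVertex.vertexFaces x, f ∈ M.faceCells → |M.hv h x - M.hf h f| = 1) → (∀ h ∈ M.configs, ∀ c, ¬M.TargetsLive c → (M.TurnConsistent h (M.cfgOf ω) c ↔ M.TurnConsistent (fun _ => 0) (M.cfgOf ∅) c)) → (∀ h ∈ M.configs, ∀ c ∈ Literature.Probability.Percolation.cornerSet M.piece,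 M.IsCut c → M.bit h c = M.bit h₀ c) → (∀ s : Literature.Probability.LatticeModels.Site 2 × Fin 4 → Bool, (∀ c ∈ Literature.Probability.Percolation.cornerSet M.piece, ¬M.IsCut c → s (Literature.Probability.LatticeModels.nextCorner (M.cfgOf ω) c) = s c) → (∀ c ∈ Literature.Probability.Percolation.cornerSet M.piece, M.IsCut c → s c = M.bit h₀ c) → ∃ h ∈ M.configs, ∀ c ∈ Literature.Probability.Percolation.cornerSet M.piece, M.bit h c = s c) → (∀ b, M.IsTracked b → M.IsCut b → ∃ (e : Literature.Probability.LatticeModels.Site 2 × Fin 4) (n : ℕ), M.IsTracked e ∧ (∃ c₀, M.IsCut c₀ ∧ Literature.Probability.LatticeModels.nextCorner (M.cfgOf ∅) c₀ = e) ∧ (Literature.Probability.LatticeModels.nextCorner (M.cfgOf ω))^[n] e = b ∧ (∀ m < n, ¬M.IsCut ((Literature.Probability.LatticeModels.nextCorner (M.cfgOf ω))^[m] e)) ∧ ∑ m ∈ Finset.range n, Literature.Probability.LatticeModels.turnSign (M.cfgOf ω) ((Literature.Probability.LatticeModels.nextCorner (M.cfgOf ω))^[m] e) = X b) → ∑ h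 ∈ M.configs, ∏ c ∈ Literature.Probability.Percolation.cornerSet M.piece, M.turnFactor h (M.cfgOf ω) c = ∏ b ∈ (Literature.Probability.Percolation.cornerSet M.piece).filter (fun c => M.IsTracked c ∧ M.IsCut c), Complex.exp (Complex.I * (Literature.Probability.Percolation.BKW.sgn (M.bit h₀ b) : ℂ) * ((Real.pi / 12 * (X b : ℝ) : ℝ) : ℂ)) :=
  fun _ _ _ h₀ X hω hunit hC hforced H5ω hstart => dict_sum_configs_eq_strandPhase hω h₀ hunit hC hforced H5ω X hstart

end Summit.CriticalPhenomena.CardyFormulaZ2.Cruxes.BoundaryDefectGaussianR.RainbowMonomialsInExcursionKernels
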